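import Summits.HubbardSuperconductivity.HubbardSuperconductivity.Theses.InfiniteVolumeFirst
import Summits.HubbardSuperconductivity.HubbardSuperconductivity.Theorems.InfiniteVolumeFirstTightnessExchange
import Summits.HubbardSuperconductivity.HubbardSuperconductivity.Theorems.FunctionFieldCertificateWindowInfraredBoundMesoscopicCeilingMajorant
import Summits.HubbardSuperconductivity.HubbardSuperconductivity.Theorems.FunctionFieldCertificateAssemblyFejerGlue

/-!
# Crux `NoInfraredPileUp` (item `stmt-HubbardSuperconductivity-18534`, route InfiniteVolumeFirst rank 3):
# the typed obstruction to a kill — PILE-UP FORCES A LIMIT ATOM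

`pileUpForcesLimitAtom`.  Model-free harmonic analysis on the tori `(ℤ/Lℤ)²`, no Hamiltonian: for ANY family
`ψ_L` of Fock vectors normalised at the even sides, if the small-momentum window tails of the `d`-wave pair
structure factor are NOT tight — `∃ η > 0 ∀ ε > 0 ∀ L₀ ∃ even L ≥ L₀, T_ε(ψ_L) = Σ_{m≠0,|q_m|≤ε} S_{ψ_L}(m) > ηL²`
— then along some strictly increasing sequence of even sides the translation-averaged pair correlations
`C_L(x) = L⁻² Σ_y G_L(x+y, y)` converge pointwise on `ℤ²` to a limit `C` with a STRICTLY POSITIVE condensate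
atom, `liminf_R R⁻⁴ Σ_{x,y ∈ [0,R)²} C(x−y) ≥ η/16 > 0`.

Consequence for the crux (with the state-uniform normal form `noInfraredPileUp_uniform`): a refutation of
`NoInfraredPileUp` is, at some doping and for couplings `U_n → 0`, an admissible Hubbard GROUND-STATE family
whose torus-limit has `d_{x²−y²}` off-diagonal long-range order — the infinite-volume form of the summit's own
conclusion for a cofinal weak-coupling family.  Refuting the crux means PROVING weak-coupling pair
condensation; this is why the standing disprover reports "no kill reachable" rather than "no kill found".
Corollary `allNormalImpliesTight`: a normalised family all of whose torus-limits (along even sides) have zero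
atom HAS tight windows — the crux is automatic wherever the route's rank-2 crux `NoNormalLimitState` fails
totally, and carries content exactly where the route is alive (ordered limit states).

Proof.  Bad even sides `s k ↑ ∞` for the windows `ε_k = 1/(k+1)` with `s k ≥ 2(k+1)`; at the side `s k` and
every block scale `1 ≤ R ≤ k+1` (`ε_k R ≤ 1`, `2R ≤ s k`): box sums of `C_L` are block pair coherence
(`tightnessExchange_boxSum_eq`), block pair coherence is `R²` times the Fejér-box pair functional `T_R`
(`re_sum_star_blockMulVec_dotProduct_eq`), and the Fejér MAJORANT (`windowSum_le_fejerMajorant`: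
`T_ε ≤ 16(T_R/R² − S(0))`) turns the bad window into `R⁻⁴ Σ_{x,y∈[0,R)²} C_{s k}(x−y) > η/16`
(`boxAvg_corrAvg_gt_of_badWindow`).  Diagonal compactness in `[−C_d², C_d²]^{ℤ²}` (as in the landed exchange
lemma) extracts a pointwise convergent subsequence; the finite box sums pass to the limit, so
`R⁻⁴ Σ_{x,y} C(x−y) ≥ η/16` for EVERY `R ≥ 1`.  Standing disprover, cdisprove cycle 1 (the strategist's
`StrategistSketch.lean` §N made a theorem).  Sources: T. Kennedy, E. H. Lieb, B. S. Shastry, PRL 61 (1988) 2582;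
J. Fröhlich, B. Simon, T. Spencer, CMP 50 (1976) 79, §3; E. M. Stein, R. Shakarchi, *Fourier Analysis* (2003)
Ch. 2 (Fejér kernel); S. Friedli, Y. Velenik (2017) §3.7.2, §10.4; M. Girardeau, Phys. Fluids 5 (1962) 1468
(generalised condensation = mass escaping to `0 < |q| → 0`).
-/

-- the mandated namespace `Summit.<Summit>.<Problem>.Theorems` repeats `HubbardSuperconductivity`
-- (single-problem summit, D-0017), which the `dupNamespace` linter flags on every declaration
set_option linter.dupNamespace false

noncomputable section

namespace Summit.HubbardSuperconductivity.HubbardSuperconductivity.Theorems.NoInfraredPileUp.Negative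

open Literature.MathematicalPhysics.QuantumLattice Literature.Probability.LatticeModels Matrix Finset Filter
open Summit.HubbardSuperconductivity.HubbardSuperconductivity.Theorems
open scoped ComplexOrder Topology

/-- **A bad window forces mesoscopic block pair order of the translation-averaged correlation** (finite
side `n + 1`, block scale `0 < R`, `2R ≤ n+1`, window `εR ≤ 1`): if `T_ε(ψ_{n+1}) > η (n+1)²` then
`R⁻⁴ Σ_{x,y ∈ [0,R)²} C_{n+1}(x − y) > η/16`.  Chain: box sums = `L⁻² Σ_a‖B_aψ‖²`
(`tightnessExchange_boxSum_eq`) `= L⁻² R² T_R` (tent identity) and `T_R/R² ≥ T_ε/16 + S(0)` (Fejér majorant).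
Kennedy–Lieb–Shastry, PRL 61 (1988) 2582; Stein–Shakarchi Ch. 2. [folklore] -/
theorem boxAvg_corrAvg_gt_of_badWindow (ψ : ∀ L, Fock (Orb (FermionTorus 2 L))) (n R : ℕ) (hR : 0 < R)
    (hRL : 2 * R ≤ n + 1) {ε η : ℝ} (hε : 0 < ε) (hεR : ε * R ≤ 1)
    (hbad : η * ((n + 1 : ℕ) : ℝ) ^ 2 < ∑ m : Fin 2 → ZMod (n + 1),
        if m ≠ 0 ∧ momentumNormSq (n + 1) m ≤ ε ^ 2 then
          pairStructureFactor dWaveFormFactor (n + 1) (ψ (n + 1)) m else 0) :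
    η / 16 < (∑ x ∈ halfOpenBox 2 R, ∑ y ∈ halfOpenBox 2 R,
        (∑ w ∈ halfOpenBox 2 (n + 1),
          torusPullback (pairFieldCorr dWaveFormFactor ψ) (n + 1) (x - y + w) w) /
            ((n + 1 : ℕ) : ℝ) ^ 2) / (R : ℝ) ^ 4 := by
  rw [tightnessExchange_boxSum_eq,
    FunctionFieldCertificateAssembly.re_sum_star_blockMulVec_dotProduct_eq R hR hRL
      (localPair dWaveFormFactor (n + 1)) (ψ (n + 1))]
  have hmaj := WindowInfraredBound.windowSum_le_fejerMajorant dWaveFormFactor (n + 1) R hR hRL ε hε hεR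
    (ψ (n + 1))
  have hS0 := pairStructureFactor_nonneg dWaveFormFactor (n + 1) (ψ (n + 1)) 0
  set T : ℝ := ∑ x : TorusSite 2 (n + 1), ∑ y : TorusSite 2 (n + 1),
      (∏ i : Fin 2, max 0 (1 - |(((y i - x i).valMinAbs : ℤ) : ℝ)| / (R : ℝ))) *
        (star (localPair dWaveFormFactor (n + 1) x *ᵥ ψ (n + 1)) ⬝ᵥ
          (localPair dWaveFormFactor (n + 1) y *ᵥ ψ (n + 1))).re with hT
  have hRpos : (0 : ℝ) < R := Nat.cast_pos.2 hR
  have hLpos : (0 : ℝ) < ((n + 1 : ℕ) : ℝ) := by positivity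
  have hR2 : (0 : ℝ) < (R : ℝ) ^ 2 := by positivity
  -- `T / R² ≥ T_ε / 16 + S(0) > η (n+1)² / 16`
  have h1 : η * ((n + 1 : ℕ) : ℝ) ^ 2 / 16 < T / (R : ℝ) ^ 2 := by linarith [hmaj, hbad, hS0]
  have h2 : (R : ℝ) ^ 2 * T / ((n + 1 : ℕ) : ℝ) ^ 2 / (R : ℝ) ^ 4 =
      T / (R : ℝ) ^ 2 / ((n + 1 : ℕ) : ℝ) ^ 2 := by
    field_simp
  rw [h2, lt_div_iff₀ (by positivity)]
  linarith

/-- **PILE-UP FORCES A LIMIT ATOM.**  For any family of torus Fock vectors normalised at the even sides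
whose small-momentum windows are NOT tight, some strictly increasing sequence of even sides carries the
translation-averaged `d`-wave pair correlations pointwise to a limit with a strictly positive condensate
atom.  Hence `¬ NoInfraredPileUp` supplies, at some `δ` and in every coupling interval `(0, U₁)`, an
admissible Hubbard ground-state family with a torus-limit having `d_{x²−y²}` ODLRO: a kill of the crux is
an infinite-volume weak-coupling pair-condensation THEOREM. Kennedy–Lieb–Shastry, PRL 61 (1988) 2582;
Fröhlich–Simon–Spencer, CMP 50 (1976) 79, §3; Friedli–Velenik (2017) §3.7.2. [folklore] -/
theorem pileUpForcesLimitAtom (ψ : ∀ L, Fock (Orb (FermionTorus 2 L)))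
    (hnorm : ∀ L, Even L → star (ψ L) ⬝ᵥ ψ L = 1)
    (hnt : ¬ (∀ η : ℝ, 0 < η → ∃ ε : ℝ, 0 < ε ∧ ∃ L₀ : ℕ, ∀ (L : ℕ) [NeZero L], Even L → L₀ ≤ L →
        (∑ m : Fin 2 → ZMod L, if m ≠ 0 ∧ momentumNormSq L m ≤ ε ^ 2 then
            pairStructureFactor dWaveFormFactor L (ψ L) m else 0) ≤ η * (L : ℝ) ^ 2)) :
    ∃ (Ls : ℕ → ℕ) (C : Site 2 → ℝ), StrictMono Ls ∧ (∀ j, Even (Ls j)) ∧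
      (∀ x : Site 2, Tendsto (fun j : ℕ => (∑ y ∈ halfOpenBox 2 (Ls j),
          torusPullback (pairFieldCorr dWaveFormFactor ψ) (Ls j) (x + y) y) / ((Ls j : ℕ) : ℝ) ^ 2)
        atTop (𝓝 (C x))) ∧
      0 < liminf (fun R : ℕ => (∑ x ∈ halfOpenBox 2 R, ∑ y ∈ halfOpenBox 2 R, C (x - y)) /
        ((R : ℕ) : ℝ) ^ 4) atTop := by
  push Not at hnt
  obtain ⟨η, hη, hbad⟩ := hnt
  -- the constant `C_d²`
  obtain ⟨B, hB⟩ : ∃ B : ℝ, B = (∑ e ∈ insert (0 : Site 2) unitSteps,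
      ‖((dWaveFormFactor e / Real.sqrt 2 : ℝ) : ℂ)‖ * 2) ^ 2 := ⟨_, rfl⟩
  have hB0 : 0 ≤ B := by rw [hB]; positivity
  -- the translation-averaged pair correlations
  obtain ⟨Cavg, hCavg⟩ : ∃ Cavg : ℕ → Site 2 → ℝ, ∀ L x, Cavg L x =
      (∑ y ∈ halfOpenBox 2 L, torusPullback (pairFieldCorr dWaveFormFactor ψ) L (x + y) y) /
        ((L : ℕ) : ℝ) ^ 2 := ⟨_, fun _ _ => rfl⟩
  -- Step 1: bad sides for the windows `1/(k+1)`
  have hkpos : ∀ k : ℕ, (0 : ℝ) < 1 / ((k : ℝ) + 1) := fun k => by positivity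
  choose side inst hEven hle hT using fun (k : ℕ) (L₀ : ℕ) => hbad (1 / ((k : ℝ) + 1)) (hkpos k) L₀
  obtain ⟨s, hs0, hs⟩ : ∃ s : ℕ → ℕ, s 0 = side 0 2 ∧ ∀ k, s (k + 1) = side (k + 1) (s k + 2 * k + 4) :=
    ⟨fun k => Nat.rec (side 0 2) (fun k sk => side (k + 1) (sk + 2 * k + 4)) k, rfl, fun _ => rfl⟩
  obtain ⟨pre, hpre0, hpre⟩ : ∃ pre : ℕ → ℕ, pre 0 = 2 ∧ ∀ k, pre (k + 1) = s k + 2 * k + 4 :=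
    ⟨fun k => Nat.rec 2 (fun k _ => s k + 2 * k + 4) k, rfl, fun _ => rfl⟩
  have hspre : ∀ k, s k = side k (pre k) := by
    intro k
    cases k with
    | zero => rw [hs0, hpre0]
    | succ k => rw [hs, hpre]
  have hpre_ge : ∀ k, 2 * (k + 1) ≤ pre k := by
    intro k
    cases k with
    | zero => rw [hpre0]
    | succ k => rw [hpre]; omega
  have hs_ge : ∀ k, 2 * (k + 1) ≤ s k := fun k => by
    rw [hspre]; exact (hpre_ge k).trans (hle k (pre k))
  have hsmono : StrictMono s := by
    refine strictMono_nat_of_lt_succ fun k => ?_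
    have h1 := hle (k + 1) (s k + 2 * k + 4)
    rw [← hs] at h1
    omega
  have hs_even : ∀ k, Even (s k) := fun k => by rw [hspre]; exact hEven k (pre k)
  -- Step 2: block pair order `> η/16` at the bad side `s k`, every block scale `1 ≤ R ≤ k + 1`
  have hside : ∀ (L : ℕ) [NeZero L] (k R : ℕ), 0 < R → 2 * R ≤ L → R ≤ k + 1 →
      η * (L : ℝ) ^ 2 < (∑ m : Fin 2 → ZMod L, if m ≠ 0 ∧ momentumNormSq L m ≤ (1 / ((k : ℝ) + 1)) ^ 2 then
          pairStructureFactor dWaveFormFactor L (ψ L) m else 0) →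
        η / 16 < (∑ x ∈ halfOpenBox 2 R, ∑ y ∈ halfOpenBox 2 R, Cavg L (x - y)) / ((R : ℕ) : ℝ) ^ 4 := by
    intro L _ k R hR hRL hRk hTL
    obtain ⟨n, rfl⟩ : ∃ n, L = n + 1 := ⟨L - 1, by omega⟩
    have hεR : 1 / ((k : ℝ) + 1) * R ≤ 1 := by
      rw [div_mul_eq_mul_div, one_mul, div_le_one (by positivity)]
      exact_mod_cast hRk
    simp only [hCavg]
    exact boxAvg_corrAvg_gt_of_badWindow ψ n R hR hRL (hkpos k) hεR hTL
  have hblock : ∀ k R : ℕ, 0 < R → R ≤ k + 1 →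
      η / 16 < (∑ x ∈ halfOpenBox 2 R, ∑ y ∈ halfOpenBox 2 R, Cavg (s k) (x - y)) / ((R : ℕ) : ℝ) ^ 4 := by
    intro k R hR hRk
    rw [hspre k]
    have h2R : 2 * R ≤ side k (pre k) := by
      have h1 := hpre_ge k
      have h2 := hle k (pre k)
      omega
    exact @hside (side k (pre k)) (inst k (pre k)) k R hR h2R hRk (hT k (pre k))
  -- Step 3: diagonal compactness — a pointwise convergent subsequence of `C_{s k}`
  have hCB : ∀ k x, |Cavg (s k) x| ≤ B := fun k x => by
    rw [hCavg, hB]; exact tightnessExchange_abs_corrAvg_le ψ _ (hnorm _ (hs_even k)) x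
  obtain ⟨K, hK⟩ : ∃ K : Set (Site 2 → ℝ), K = Set.pi Set.univ fun _ => Set.Icc (-B) B := ⟨_, rfl⟩
  have hKc : IsCompact K := hK ▸ isCompact_univ_pi fun _ => isCompact_Icc
  have hmem : ∀ k, (fun x => Cavg (s k) x) ∈ K := fun k =>
    hK ▸ Set.mem_univ_pi.2 fun x => abs_le.1 (hCB k x)
  obtain ⟨C, hCK, φ, hφ, hconv⟩ := hKc.tendsto_subseq hmem
  rw [hK] at hCK
  have hCbd : ∀ x, |C x| ≤ B := fun x => abs_le.2 (Set.mem_univ_pi.1 hCK x)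
  -- the subsequence of sides
  obtain ⟨Ls, hLs⟩ : ∃ Ls : ℕ → ℕ, ∀ j, Ls j = s (φ j) := ⟨_, fun _ => rfl⟩
  have hLs_mono : StrictMono Ls := fun a b hab => by
    rw [hLs, hLs]; exact hsmono (hφ hab)
  have hLs_even : ∀ j, Even (Ls j) := fun j => hLs j ▸ hs_even _
  have hLs_conv : ∀ x : Site 2, Tendsto (fun j => Cavg (Ls j) x) atTop (𝓝 (C x)) := fun x =>
    (tendsto_pi_nhds.1 hconv x).congr fun j => by simp only [Function.comp_apply, hLs]
  -- Step 4: the atom of the limit is at least `η/16`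
  obtain ⟨b, hb⟩ : ∃ b : ℕ → ℝ, ∀ R, b R = (∑ x ∈ halfOpenBox 2 R, ∑ y ∈ halfOpenBox 2 R,
      C (x - y)) / ((R : ℕ) : ℝ) ^ 4 := ⟨_, fun _ => rfl⟩
  have hbR : ∀ R : ℕ, 0 < R → η / 16 ≤ b R := by
    intro R hR
    have hbj : Tendsto (fun j => (∑ x ∈ halfOpenBox 2 R, ∑ y ∈ halfOpenBox 2 R,
        Cavg (Ls j) (x - y)) / ((R : ℕ) : ℝ) ^ 4) atTop (𝓝 (b R)) := by
      rw [hb]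
      exact (tendsto_finsetSum _ fun x _ => tendsto_finsetSum _ fun y _ =>
        hLs_conv (x - y)).div_const _
    refine ge_of_tendsto hbj (eventually_atTop.2 ⟨R, fun j hj => ?_⟩)
    have hφj : j ≤ φ j := hφ.id_le j
    rw [hLs]
    exact (hblock (φ j) R hR (by omega)).le
  have hb_up : ∀ R, b R ≤ B := by
    intro R
    have habs : |b R| ≤ B := by
      rw [hb, abs_div, abs_of_nonneg (by positivity : (0 : ℝ) ≤ ((R : ℕ) : ℝ) ^ 4)]
      rcases Nat.eq_zero_or_pos R with rfl | hRpos
      · simpa using hB0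
      · rw [div_le_iff₀ (by positivity)]
        calc |∑ x ∈ halfOpenBox 2 R, ∑ y ∈ halfOpenBox 2 R, C (x - y)|
            ≤ ∑ x ∈ halfOpenBox 2 R, |∑ y ∈ halfOpenBox 2 R, C (x - y)| :=
              Finset.abs_sum_le_sum_abs _ _
          _ ≤ ∑ x ∈ halfOpenBox 2 R, ∑ y ∈ halfOpenBox 2 R, |C (x - y)| :=
              Finset.sum_le_sum fun x _ => Finset.abs_sum_le_sum_abs _ _
          _ ≤ ∑ x ∈ halfOpenBox 2 R, ∑ y ∈ halfOpenBox 2 R, B :=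
              Finset.sum_le_sum fun x _ => Finset.sum_le_sum fun y _ => hCbd _
          _ = B * ((R : ℕ) : ℝ) ^ 4 := by
              rw [Finset.sum_const, Finset.sum_const, card_halfOpenBox, smul_smul, nsmul_eq_mul]
              push_cast
              ring
    exact (abs_le.1 habs).2
  have hlim : η / 16 ≤ liminf b atTop :=
    le_liminf_of_le (isCoboundedUnder_ge_of_le atTop hb_up)
      (eventually_atTop.2 ⟨1, fun R hR => hbR R hR⟩)
  refine ⟨Ls, C, hLs_mono, hLs_even, fun x => ?_, ?_⟩
  · simpa only [hCavg] using hLs_conv x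
  · have hfun : (fun R : ℕ => (∑ x ∈ halfOpenBox 2 R, ∑ y ∈ halfOpenBox 2 R, C (x - y)) /
        ((R : ℕ) : ℝ) ^ 4) = b := funext fun R => (hb R).symm
    rw [hfun]
    linarith

/-- **ALL-NORMAL ⇒ TIGHT** (contrapositive reading, pure logic from `pileUpForcesLimitAtom`): if EVERY
pointwise torus-limit (along strictly increasing even sides) of the translation-averaged `d`-wave pair
correlations of a family normalised at even sides has condensate atom `≤ 0`, then the family's small-momentum
windows are tight.  So the crux `NoInfraredPileUp` is AUTOMATIC for every admissible family all of whose
limits are normal — its content lives exactly where the route is alive (ordered limit states, `η` below the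
atom), behind the twist wall of `…/Negative/NearGroundStates.lean`. [folklore] -/
theorem allNormalImpliesTight (ψ : ∀ L, Fock (Orb (FermionTorus 2 L)))
    (hnorm : ∀ L, Even L → star (ψ L) ⬝ᵥ ψ L = 1)
    (hnormal : ∀ (Ls : ℕ → ℕ) (C : Site 2 → ℝ), StrictMono Ls → (∀ j, Even (Ls j)) →
      (∀ x : Site 2, Tendsto (fun j : ℕ => (∑ y ∈ halfOpenBox 2 (Ls j),
          torusPullback (pairFieldCorr dWaveFormFactor ψ) (Ls j) (x + y) y) / ((Ls j : ℕ) : ℝ) ^ 2)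
        atTop (𝓝 (C x))) →
        liminf (fun R : ℕ => (∑ x ∈ halfOpenBox 2 R, ∑ y ∈ halfOpenBox 2 R, C (x - y)) /
          ((R : ℕ) : ℝ) ^ 4) atTop ≤ 0) :
    ∀ η : ℝ, 0 < η → ∃ ε : ℝ, 0 < ε ∧ ∃ L₀ : ℕ, ∀ (L : ℕ) [NeZero L], Even L → L₀ ≤ L →
      (∑ m : Fin 2 → ZMod L, if m ≠ 0 ∧ momentumNormSq L m ≤ ε ^ 2 then
          pairStructureFactor dWaveFormFactor L (ψ L) m else 0) ≤ η * (L : ℝ) ^ 2 := by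
  by_contra hnt
  obtain ⟨Ls, C, hLs, hev, hconv, hatom⟩ := pileUpForcesLimitAtom ψ hnorm hnt
  exact absurd (hnormal Ls C hLs hev hconv) (not_le.2 hatom)

end Summit.HubbardSuperconductivity.HubbardSuperconductivity.Theorems.NoInfraredPileUp.Negative
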